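import Mathlib
import Literature.Probability.Percolation.PercolationProofs
import Literature.Probability.Percolation.ClusterBoundary
import Literature.Probability.LatticeModels.ProdBernoulliIndependence
import Summits.CriticalPhenomena.PercolationContinuityZ3.Theorems.PercNearOneGluingAdditiveGluingSigmaRecursion
import HarnessLib

/-!
# Crux `PercNearOneGluing.AdditiveGluing` (stmt-CriticalPhenomena-4576), line `subuniform-dead-pocket-maximum`
# — the EXCHANGE NORMAL FORM of the good-quadruple inequality (bridge for `stub_goodStep`)

Helper file for the crux (siege seat k46 on the hardest stub `stub_goodStep` of the skeleton
`Cruxes/AdditiveGluing/Lines/subuniform-dead-pocket-maximum.lean`); lands with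
`--supports stmt-CriticalPhenomena-4576`.  No new definitions.

Notation: `μ = prodBernoulli w` on bond configurations of the complete weighted graph on `Fin n`;
target `b ∈ A`, observer `o ∉ A`; `U = ⋃_{a ∈ A} {o ↔ a}`; a DEAD POCKET is a vertex set `W ∋ o` with
`W ∩ A = ∅`, `{C(o) = W} = clusterIs o W`; `τ_W(x) = μ(x ↔ b in Wᶜ)`.

The registered conclusion of `stub_goodStep` (and of `stub_goodBase`, `good_all`) is the LINEAR
SELECTION FORM of Kozma–Nitzan's "good quadruple" inequality (arXiv:2401.12397 §3.2 p. 12):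
`Φ(A) + Σ_{W dead} μ(C(o) = W) · (1 − τ_W(sel W)) ≤ t` for every level `t` with `1 − t ≤ μ(a ↔ b)`
on `A` and every selection `sel W ∈ A`, where `Φ(A) = μ(U ∩ {o ↮ b})` is the live failure.
Every analysis of the stub (lead c1's `Lines/subuniform-dead-pocket-maximum-goodstep-c1.md`, this
seat's `siege-k46-induction-on-relays.md`) works instead with the EXCHANGE FORM at a relay `a₀`:

  `X(a₀) + Σ_{W dead} μ(C(o) = W) · (τ_W(a₀) − τ_W(sel W)) ≤ Y(a₀)`,
  `X(a₀) = μ(a₀ ↔ b, o ↮ b, o ↔ A)`,  `Y(a₀) = μ(o ↔ b, a₀ ↮ b)`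

(for the `τ`-minimiser `a₀` and the worst selection this is "`X + Pen ≤ Y`", KN's form of goodness
`P(o ↔ b) ≥ min_a τ(a) − Σ_W P(C(o) = W) min_a τ_{G−W}(a)`).  This file proves the bridge between the
two, as an exact IDENTITY valid for every `a₀ ∈ A` and every selection (`goodBridge_identity`):

  `Φ(A) + Σ_W μ(C(o)=W)(1 − τ_W(sel W)) = (1 − μ(a₀ ↔ b)) − Y(a₀) + X(a₀) + Σ_W μ(C(o)=W)(τ_W(a₀) − τ_W(sel W))`,

whence (`good_of_exchange`, and in registered-stub shape `stub_goodOfExchange_k46`) the registered conclusion follows from the exchange form at any single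
`a₀ ∈ A` (the level hypothesis is used only at `a₀`; no minimality is needed for the bridge itself).
Ingredients: the partition of `{o ↮ A}` by the value of `C(o)` (`sigmaRec_sum_preimage_inter`),
and the spatial Markov property of a dead pocket, `μ(C(o) = W, a₀ ↔ b) = μ(C(o) = W) · τ_W(a₀)`
(`determinedBy_clusterIs` + `prodBernoulli_real_inter_of_determinedBy`; on `{C(o) = W}` an open path
from `a₀ ∉ W` to `b` avoids `W`).  As a first use, `good_of_card_erase_le_one`: the registered conclusion
holds outright when `|A ∖ b| ≤ 1` (rungs 0–1 of an induction on the number of relays; the exchange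
form is then trivial, `goodBridge_exchange_of_subset_pair`).
-/

namespace Summit.CriticalPhenomena.PercolationContinuityZ3.Theorems

open MeasureTheory Set
open Literature.Probability.LatticeModels (prodBernoulli prodBernoulli_real_inter_of_determinedBy)
open Literature.Probability.Percolation
open Literature.Barriers.CriticalPhenomena (pathIn_of_walk_support_subset)
open scoped BigOperators

noncomputable section
open Classical

variable {n : ℕ}

/-! ### Pointwise facts about the pocket events `{C(o) = W}` -/

/-- The stub's pocket event `{ω | C(o) = W}` is `clusterIs o W`. [folklore] -/
theorem goodBridge_setOf_eq_clusterIs (o : Fin n) (W : Finset (Fin n)) :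
    {ω : BondConfig (Fin n) | openCluster ω o = (W : Set (Fin n))} = clusterIs o W := rfl

/-- A dead pocket sees no relay: if `W ∩ A = ∅` then `{C(o) = W} ⊆ (⋃_{a ∈ A} {o ↔ a})ᶜ`. [folklore] -/
theorem goodBridge_clusterIs_subset_compl_iUnion (A W : Finset (Fin n)) (o : Fin n)
    (hWA : Disjoint W A) :
    clusterIs o W ⊆ (⋃ a ∈ A, (openConn o a : Set (BondConfig (Fin n))))ᶜ := by
  intro ω hω hU
  rw [Set.mem_iUnion₂] at hU
  obtain ⟨a, haA, hoa⟩ := hU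
  rw [mem_clusterIs] at hω
  have ha : a ∈ openCluster ω o := hoa
  rw [hω] at ha
  exact Finset.disjoint_left.1 hWA (by exact_mod_cast ha) haA

/-- A pocket that is not dead meets `(⋃_{a ∈ A} {o ↔ a})ᶜ` trivially: if `o ∉ W` the event
`{C(o) = W}` is empty, and if `W` meets `A` at `a` then `o ↔ a` on it. [folklore] -/
theorem goodBridge_clusterIs_inter_eq_empty (A W : Finset (Fin n)) (o : Fin n)
    (hW : ¬ (o ∈ W ∧ Disjoint W A)) :
    clusterIs o W ∩ (⋃ a ∈ A, (openConn o a : Set (BondConfig (Fin n))))ᶜ = ∅ := by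
  ext ω
  simp only [Set.mem_inter_iff, Set.mem_empty_iff_false, iff_false, not_and, Set.mem_compl_iff,
    not_not]
  intro hω
  by_cases hoW : o ∈ W
  · have hnd : ¬ Disjoint W A := fun h => hW ⟨hoW, h⟩
    rw [Finset.not_disjoint_iff] at hnd
    obtain ⟨a, haW, haA⟩ := hnd
    rw [mem_clusterIs] at hω
    have ha : a ∈ openCluster ω o := by rw [hω]; exact_mod_cast haW
    exact Set.mem_iUnion₂.2 ⟨a, haA, ha⟩
  · rw [clusterIs_eq_empty_of_notMem hoW] at hω
    exact absurd hω (Set.notMem_empty ω)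

/-- On `{C(o) = W}` with `a ∉ W`, an open path from `a` to `b` avoids `W` (else `a ∈ C(o)`):
`{C(o) = W} ∩ {a ↔ b} = {C(o) = W} ∩ {a ↔ b in Wᶜ}`. [folklore; Grimmett 1999 §1.3] -/
theorem goodBridge_clusterIs_inter_openConn (W : Finset (Fin n)) (o a b : Fin n) (haW : a ∉ W) :
    clusterIs o W ∩ openConn a b = clusterIs o W ∩ openConnIn ((W : Set (Fin n))ᶜ) a b := by
  ext ω
  constructor
  · rintro ⟨hW, hab⟩
    refine ⟨hW, ?_⟩
    rw [mem_clusterIs] at hW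
    obtain ⟨p⟩ := (hab : (openGraph ω).Reachable a b)
    have hsupp : ∀ v ∈ p.support, v ∈ ((W : Set (Fin n))ᶜ) := by
      intro v hv hvW
      have hav : (openGraph ω).Reachable a v := ⟨p.takeUntil v hv⟩
      have hov : v ∈ openCluster ω o := by rw [hW]; exact hvW
      have hoa : a ∈ openCluster ω o := (show (openGraph ω).Reachable o v from hov).trans hav.symm
      rw [hW] at hoa
      exact haW (by exact_mod_cast hoa)
    exact DCT16.mem_openConnIn_of_pathIn (pathIn_of_walk_support_subset p hsupp)
  · rintro ⟨hW, hab⟩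
    exact ⟨hW, openConnIn_subset_openConn _ a b hab⟩

/-! ### Measure facts: partition by the value of `C(o)` and the pocket Markov property -/

/-- **Partition of `{o ↮ A}` by the dead pockets**: for every event `S`,
`μ(S ∩ (⋃_{a∈A}{o ↔ a})ᶜ) = Σ_{W ∋ o, W ∩ A = ∅} μ({C(o) = W} ∩ S)`. [folklore; Grimmett 1999 §1.3] -/
theorem goodBridge_real_inter_compl_iUnion (w : Sym2 (Fin n) → unitInterval) (A : Finset (Fin n))
    (o : Fin n) (S : Set (BondConfig (Fin n))) :
    (prodBernoulli w).real (S ∩ (⋃ a ∈ A, (openConn o a : Set (BondConfig (Fin n))))ᶜ) =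
      ∑ W ∈ (Finset.univ : Finset (Finset (Fin n))).filter (fun W => o ∈ W ∧ Disjoint W A),
        (prodBernoulli w).real (clusterIs o W ∩ S) := by
  set f : BondConfig (Fin n) → Finset (Fin n) := fun ω => Finset.univ.filter fun v => v ∈ openCluster ω o
    with hf
  have hfib : ∀ W : Finset (Fin n), f ⁻¹' {W} = clusterIs o W := by
    intro W
    ext ω
    simp only [Set.mem_preimage, Set.mem_singleton_iff, mem_clusterIs, hf, Finset.ext_iff,
      Set.ext_iff, Finset.mem_filter, Finset.mem_univ, true_and, Finset.mem_coe]
  have h := sigmaRec_sum_preimage_inter w f (S ∩ (⋃ a ∈ A, (openConn o a : Set (BondConfig (Fin n))))ᶜ)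
  rw [← h, ← Finset.sum_filter_add_sum_filter_not Finset.univ (fun W => o ∈ W ∧ Disjoint W A)]
  have hzero : ∑ W ∈ Finset.univ.filter (fun W : Finset (Fin n) => ¬ (o ∈ W ∧ Disjoint W A)),
      (prodBernoulli w).real (f ⁻¹' {W} ∩ (S ∩ (⋃ a ∈ A, (openConn o a : Set (BondConfig (Fin n))))ᶜ)) = 0 := by
    refine Finset.sum_eq_zero fun W hW => ?_
    rw [Finset.mem_filter] at hW
    rw [hfib, ← Set.inter_assoc, Set.inter_comm (clusterIs o W) S, Set.inter_assoc,
      goodBridge_clusterIs_inter_eq_empty A W o hW.2, Set.inter_empty, measureReal_empty]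
  rw [hzero, add_zero]
  refine Finset.sum_congr rfl fun W hW => ?_
  rw [Finset.mem_filter] at hW
  rw [hfib]
  congr 1
  rw [← Set.inter_assoc, Set.inter_eq_left.2]
  exact Set.inter_subset_left.trans (goodBridge_clusterIs_subset_compl_iUnion A W o hW.2.2)

/-- **Spatial Markov property of a pocket**: for `a ∉ W`,
`μ({C(o) = W} ∩ {a ↔ b}) = μ(C(o) = W) · μ(a ↔ b in Wᶜ)` — `{C(o) = W}` is determined by the pairs
touching `W`, `{a ↔ b in Wᶜ}` by the pairs inside `Wᶜ`. [folklore; Grimmett 1999 §2.2] -/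
theorem goodBridge_real_clusterIs_inter_openConn (w : Sym2 (Fin n) → unitInterval)
    (W : Finset (Fin n)) (o a b : Fin n) (haW : a ∉ W) :
    (prodBernoulli w).real (clusterIs o W ∩ openConn a b) =
      (prodBernoulli w).real (clusterIs o W) *
        (prodBernoulli w).real (openConnIn ((W : Set (Fin n))ᶜ) a b) := by
  rw [goodBridge_clusterIs_inter_openConn W o a b haW]
  set F : Finset (Sym2 (Fin n)) := (Set.toFinite (edgesTouching (↑W : Set (Fin n)))).toFinset
    with hF
  have hFc : (↑F : Set (Sym2 (Fin n))) = edgesTouching (↑W : Set (Fin n)) := by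
    rw [hF, Set.Finite.coe_toFinset]
  refine prodBernoulli_real_inter_of_determinedBy w F ?_ ?_ (Set.toFinite _).measurableSet
    (Set.toFinite _).measurableSet
  · rw [hFc]; exact determinedBy_clusterIs o W
  · rw [hFc]
    exact (DCT16.determinedBy_openConnIn _ a b le_rfl).mono
      (disjoint_edgesTouching_compl_sym2 _).subset_compl_left

/-! ### The bridge -/

/-- **Exchange normal form of the good-quadruple inequality (identity).**  For `b ∈ A`, any
`a₀ ∈ A` and any selection `sel`, with dead pockets `W ∋ o`, `W ∩ A = ∅`:
`μ(U ∩ {o↮b}) + Σ_W μ(C(o)=W)·μ({sel W ↔ b in Wᶜ}ᶜ)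
  = μ({a₀↔b}ᶜ) − μ({o↔b} ∩ {a₀↔b}ᶜ) + μ({a₀↔b} ∩ {o↔b}ᶜ ∩ U) + Σ_W μ(C(o)=W)·(τ_W(a₀) − τ_W(sel W))`,
`U = ⋃_{a∈A}{o↔a}`, `τ_W(x) = μ(x ↔ b in Wᶜ)`.  (Elementary bookkeeping on the partition
`Ω = {o↔b} ⊔ (U ∖ {o↔b}) ⊔ ⊔_W {C(o)=W}` plus the pocket Markov property; the form in which
Kozma–Nitzan arXiv:2401.12397 §3.2 p. 12 state goodness.) -/
theorem goodBridge_identity (w : Sym2 (Fin n) → unitInterval) (A : Finset (Fin n)) (o b a₀ : Fin n)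
    (hbA : b ∈ A) (ha₀A : a₀ ∈ A) (sel : Finset (Fin n) → Fin n) :
    (prodBernoulli w).real ((⋃ a ∈ A, openConn o a) ∩ (openConn o b)ᶜ)
      + ∑ W ∈ (Finset.univ : Finset (Finset (Fin n))).filter (fun W => o ∈ W ∧ Disjoint W A),
          (prodBernoulli w).real {ω : BondConfig (Fin n) | openCluster ω o = (W : Set (Fin n))}
            * (prodBernoulli w).real (openConnIn ((W : Set (Fin n))ᶜ) (sel W) b)ᶜ
    = (prodBernoulli w).real (openConn a₀ b : Set (BondConfig (Fin n)))ᶜ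
      - (prodBernoulli w).real (openConn o b ∩ (openConn a₀ b)ᶜ)
      + (prodBernoulli w).real (openConn a₀ b ∩ (openConn o b)ᶜ ∩ ⋃ a ∈ A, openConn o a)
      + ∑ W ∈ (Finset.univ : Finset (Finset (Fin n))).filter (fun W => o ∈ W ∧ Disjoint W A),
          (prodBernoulli w).real {ω : BondConfig (Fin n) | openCluster ω o = (W : Set (Fin n))}
            * ((prodBernoulli w).real (openConnIn ((W : Set (Fin n))ᶜ) a₀ b)
                - (prodBernoulli w).real (openConnIn ((W : Set (Fin n))ᶜ) (sel W) b)) := by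
  -- abbreviations
  set μ := prodBernoulli w with hμ
  set U : Set (BondConfig (Fin n)) := ⋃ a ∈ A, openConn o a with hU
  set Ob : Set (BondConfig (Fin n)) := openConn o b with hOb
  set Sa : Set (BondConfig (Fin n)) := openConn a₀ b with hSa
  set D := (Finset.univ : Finset (Finset (Fin n))).filter (fun W => o ∈ W ∧ Disjoint W A) with hD
  have hms : ∀ s : Set (BondConfig (Fin n)), MeasurableSet s := fun s => (Set.toFinite s).measurableSet
  have hObU : Ob ⊆ U := fun ω hω => Set.mem_iUnion₂.2 ⟨b, hbA, hω⟩
  -- (1) three-way split of `μ(Saᶜ)`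
  have h1 : μ.real Saᶜ = μ.real (Saᶜ ∩ Ob) + μ.real (Saᶜ ∩ Obᶜ ∩ U) + μ.real (Saᶜ ∩ Uᶜ) := by
    have e1 := (measureReal_inter_add_sdiff (μ := μ) (s := Saᶜ) (hms U)).symm
    rw [Set.sdiff_eq] at e1
    have e2 := (measureReal_inter_add_sdiff (μ := μ) (s := Saᶜ ∩ U) (hms Ob)).symm
    rw [Set.sdiff_eq] at e2
    have e3 : Saᶜ ∩ U ∩ Ob = Saᶜ ∩ Ob := by
      ext ω; simp only [Set.mem_inter_iff, Set.mem_compl_iff]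
      exact ⟨fun h => ⟨h.1.1, h.2⟩, fun h => ⟨⟨h.1, hObU h.2⟩, h.2⟩⟩
    have e4 : Saᶜ ∩ U ∩ Obᶜ = Saᶜ ∩ Obᶜ ∩ U := by
      ext ω; simp only [Set.mem_inter_iff, Set.mem_compl_iff]; tauto
    rw [e1, e2, e3, e4]
  -- (2) two-way split of the live failure `μ(U ∩ Obᶜ)`
  have h2 : μ.real (U ∩ Obᶜ) = μ.real (Sa ∩ Obᶜ ∩ U) + μ.real (Saᶜ ∩ Obᶜ ∩ U) := by
    have e1 := (measureReal_inter_add_sdiff (μ := μ) (s := U ∩ Obᶜ) (hms Sa)).symm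
    rw [Set.sdiff_eq] at e1
    have e2 : U ∩ Obᶜ ∩ Sa = Sa ∩ Obᶜ ∩ U := by
      ext ω; simp only [Set.mem_inter_iff, Set.mem_compl_iff]; tauto
    have e3 : U ∩ Obᶜ ∩ Saᶜ = Saᶜ ∩ Obᶜ ∩ U := by
      ext ω; simp only [Set.mem_inter_iff, Set.mem_compl_iff]; tauto
    rw [e1, e2, e3]
  -- (3) the dead part of `μ(Saᶜ)` as a pocket sum, and the pocket Markov property
  have h3 : μ.real (Saᶜ ∩ Uᶜ) = ∑ W ∈ D, (μ.real (clusterIs o W)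
      - μ.real (clusterIs o W) * μ.real (openConnIn ((W : Set (Fin n))ᶜ) a₀ b)) := by
    rw [hU, goodBridge_real_inter_compl_iUnion w A o Saᶜ]
    refine Finset.sum_congr rfl fun W hW => ?_
    rw [Finset.mem_filter] at hW
    have ha₀W : a₀ ∉ W := fun h => Finset.disjoint_left.1 hW.2.2 h ha₀A
    have e : clusterIs o W ∩ Saᶜ = clusterIs o W ∩ (clusterIs o W ∩ Sa)ᶜ := by
      ext ω; simp only [Set.mem_inter_iff, Set.mem_compl_iff]; tauto
    rw [e, ← Set.sdiff_eq, measureReal_sdiff Set.inter_subset_left (hms _),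
      goodBridge_real_clusterIs_inter_openConn w W o a₀ b ha₀W]
  -- (4) complements of the selected connections
  have h4 : ∀ W : Finset (Fin n), μ.real (openConnIn ((W : Set (Fin n))ᶜ) (sel W) b)ᶜ =
      1 - μ.real (openConnIn ((W : Set (Fin n))ᶜ) (sel W) b) := fun W =>
    probReal_compl_eq_one_sub (hms _)
  -- (5) assemble
  have hsum : ∑ W ∈ D, μ.real {ω : BondConfig (Fin n) | openCluster ω o = (W : Set (Fin n))}
        * μ.real (openConnIn ((W : Set (Fin n))ᶜ) (sel W) b)ᶜ
      = ∑ W ∈ D, (μ.real (clusterIs o W)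
          - μ.real (clusterIs o W) * μ.real (openConnIn ((W : Set (Fin n))ᶜ) a₀ b))
        + ∑ W ∈ D, μ.real {ω : BondConfig (Fin n) | openCluster ω o = (W : Set (Fin n))}
          * (μ.real (openConnIn ((W : Set (Fin n))ᶜ) a₀ b)
              - μ.real (openConnIn ((W : Set (Fin n))ᶜ) (sel W) b)) := by
    rw [← Finset.sum_add_distrib]
    refine Finset.sum_congr rfl fun W _ => ?_
    rw [h4 W, goodBridge_setOf_eq_clusterIs]
    ring
  have hY : μ.real (Ob ∩ Saᶜ) = μ.real (Saᶜ ∩ Ob) := by rw [Set.inter_comm]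
  rw [hsum, ← h3, h2, hY, h1]
  ring

/-- **Goodness from the exchange form at one relay.**  If `b ∈ A`, `a₀ ∈ A`, the level `t` satisfies
`1 − t ≤ μ(a₀ ↔ b)`, and the selection `sel` satisfies the exchange inequality at `a₀`,
`μ(a₀↔b, o↮b, o↔A) + Σ_{W dead} μ(C(o)=W)(τ_W(a₀) − τ_W(sel W)) ≤ μ(o↔b, a₀↮b)`, then the registered
conclusion of `stub_goodStep` holds for `(t, sel)`:
`μ(o ↔ A, o ↮ b) + Σ_{W dead} μ(C(o) = W)·μ({sel W ↔ b in Wᶜ}ᶜ) ≤ t`.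
(Kozma–Nitzan arXiv:2401.12397 §3.2 p. 12: "`X + Pen ≤ Y`" form of goodness ⟹ linear selection form.) -/
theorem good_of_exchange (w : Sym2 (Fin n) → unitInterval) (A : Finset (Fin n)) (o b a₀ : Fin n)
    (hbA : b ∈ A) (ha₀A : a₀ ∈ A) (t : ℝ) (sel : Finset (Fin n) → Fin n)
    (hrel : 1 - t ≤ (prodBernoulli w).real (openConn a₀ b))
    (hex : (prodBernoulli w).real (openConn a₀ b ∩ (openConn o b)ᶜ ∩ ⋃ a ∈ A, openConn o a)
      + ∑ W ∈ (Finset.univ : Finset (Finset (Fin n))).filter (fun W => o ∈ W ∧ Disjoint W A),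
          (prodBernoulli w).real {ω : BondConfig (Fin n) | openCluster ω o = (W : Set (Fin n))}
            * ((prodBernoulli w).real (openConnIn ((W : Set (Fin n))ᶜ) a₀ b)
                - (prodBernoulli w).real (openConnIn ((W : Set (Fin n))ᶜ) (sel W) b))
      ≤ (prodBernoulli w).real (openConn o b ∩ (openConn a₀ b)ᶜ)) :
    (prodBernoulli w).real ((⋃ a ∈ A, openConn o a) ∩ (openConn o b)ᶜ)
      + ∑ W ∈ (Finset.univ : Finset (Finset (Fin n))).filter (fun W => o ∈ W ∧ Disjoint W A),
          (prodBernoulli w).real {ω : BondConfig (Fin n) | openCluster ω o = (W : Set (Fin n))}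
            * (prodBernoulli w).real (openConnIn ((W : Set (Fin n))ᶜ) (sel W) b)ᶜ
      ≤ t := by
  rw [goodBridge_identity w A o b a₀ hbA ha₀A sel]
  have hc : (prodBernoulli w).real (openConn a₀ b : Set (BondConfig (Fin n)))ᶜ =
      1 - (prodBernoulli w).real (openConn a₀ b) :=
    probReal_compl_eq_one_sub (Set.toFinite _).measurableSet
  rw [hc]
  linarith

/-- **The registered conclusion from the exchange form at a `τ`-minimiser** (the shape in which a
proof of `stub_goodStep` is expected to arrive): if `b ∈ A` and for some `a₀ ∈ A` minimising
`μ(· ↔ b)` over `A` every selection `sel W ∈ A` satisfies the exchange inequality at `a₀`, then the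
quadruple `(w, A, o, b)` is good in the skeleton's linear selection form (all levels `t`, all
selections).  [Kozma–Nitzan arXiv:2401.12397 §3.2 p. 12] -/
theorem stub_goodOfExchange_k46 :
    ∀ (n : ℕ) (w : Sym2 (Fin n) → unitInterval) (A : Finset (Fin n)) (o b a₀ : Fin n),
      b ∈ A → a₀ ∈ A →
      (∀ sel : Finset (Fin n) → Fin n, (∀ W, sel W ∈ A) →
        (prodBernoulli w).real (openConn a₀ b ∩ (openConn o b)ᶜ ∩ ⋃ a ∈ A, openConn o a)
        + ∑ W ∈ (Finset.univ : Finset (Finset (Fin n))).filter (fun W => o ∈ W ∧ Disjoint W A),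
            (prodBernoulli w).real {ω : BondConfig (Fin n) | openCluster ω o = (W : Set (Fin n))}
              * ((prodBernoulli w).real (openConnIn ((W : Set (Fin n))ᶜ) a₀ b)
                  - (prodBernoulli w).real (openConnIn ((W : Set (Fin n))ᶜ) (sel W) b))
        ≤ (prodBernoulli w).real (openConn o b ∩ (openConn a₀ b)ᶜ)) →
      ∀ (t : ℝ) (sel : Finset (Fin n) → Fin n), (∀ W, sel W ∈ A) →
        (∀ a ∈ A, 1 - t ≤ (prodBernoulli w).real (openConn a b)) →
        (prodBernoulli w).real ((⋃ a ∈ A, openConn o a) ∩ (openConn o b)ᶜ)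
          + ∑ W ∈ (Finset.univ : Finset (Finset (Fin n))).filter (fun W => o ∈ W ∧ Disjoint W A),
              (prodBernoulli w).real {ω : BondConfig (Fin n) | openCluster ω o = (W : Set (Fin n))}
                * (prodBernoulli w).real (openConnIn ((W : Set (Fin n))ᶜ) (sel W) b)ᶜ
          ≤ t :=
  fun _ w A o b a₀ hbA ha₀A hex t sel hsel hlev =>
    good_of_exchange w A o b a₀ hbA ha₀A t sel (hlev a₀ ha₀A) (hex sel hsel)

/-! ### The first two rungs of an induction on `|A ∖ b|`: goodness for `A ⊆ {a₀, b}` -/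

/-- **The exchange inequality is trivial when `A ⊆ {a₀, b}`**: then `X(a₀) = 0` (on `{o ↔ A, o ↮ b}`
the observer reaches `a₀`, so `a₀ ↔ b` would give `o ↔ b`), and every penalty summand is `≤ 0`
because `sel W ∈ {a₀, b}` and `τ_W(b) = 1`.  [Kozma–Nitzan arXiv:2401.12397 §3.2: goodness with one
relay is the identity `0 ≤ μ(o ↔ b, a₀ ↮ b)`] -/
theorem goodBridge_exchange_of_subset_pair (w : Sym2 (Fin n) → unitInterval) (A : Finset (Fin n))
    (o b a₀ : Fin n) (hbA : b ∈ A) (hA : A ⊆ {a₀, b}) (sel : Finset (Fin n) → Fin n)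
    (hsel : ∀ W, sel W ∈ A) :
    (prodBernoulli w).real (openConn a₀ b ∩ (openConn o b)ᶜ ∩ ⋃ a ∈ A, openConn o a)
      + ∑ W ∈ (Finset.univ : Finset (Finset (Fin n))).filter (fun W => o ∈ W ∧ Disjoint W A),
          (prodBernoulli w).real {ω : BondConfig (Fin n) | openCluster ω o = (W : Set (Fin n))}
            * ((prodBernoulli w).real (openConnIn ((W : Set (Fin n))ᶜ) a₀ b)
                - (prodBernoulli w).real (openConnIn ((W : Set (Fin n))ᶜ) (sel W) b))
      ≤ (prodBernoulli w).real (openConn o b ∩ (openConn a₀ b)ᶜ) := by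
  -- `X(a₀) = 0`
  have hX : (openConn a₀ b ∩ (openConn o b)ᶜ ∩ ⋃ a ∈ A, openConn o a : Set (BondConfig (Fin n))) = ∅ := by
    ext ω
    simp only [Set.mem_inter_iff, Set.mem_compl_iff, Set.mem_iUnion, Set.mem_empty_iff_false,
      iff_false, not_and, not_exists]
    rintro ⟨hab, hob⟩ a haA hoa
    have ha : a = a₀ ∨ a = b := by simpa [Finset.mem_insert, Finset.mem_singleton] using hA haA
    rcases ha with rfl | rfl
    · exact hob ((show (openGraph ω).Reachable o a from hoa).trans hab)
    · exact hob hoa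
  rw [hX, measureReal_empty, zero_add]
  -- every penalty summand is `≤ 0`
  refine (Finset.sum_nonpos fun W hW => ?_).trans measureReal_nonneg
  rw [Finset.mem_filter] at hW
  refine mul_nonpos_of_nonneg_of_nonpos measureReal_nonneg (sub_nonpos.2 ?_)
  have hs : sel W = a₀ ∨ sel W = b := by
    simpa [Finset.mem_insert, Finset.mem_singleton] using hA (hsel W)
  rcases hs with h | h
  · rw [h]
  · rw [h]
    have hbW : b ∈ ((W : Set (Fin n))ᶜ) := fun hbW' =>
      Finset.disjoint_left.1 hW.2.2 (by exact_mod_cast hbW') hbA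
    have huniv : (openConnIn ((W : Set (Fin n))ᶜ) b b : Set (BondConfig (Fin n))) = Set.univ :=
      Set.eq_univ_of_forall fun ω => ⟨hbW, hbW, SimpleGraph.Reachable.refl _⟩
    rw [huniv, probReal_univ]
    exact measureReal_le_one

/-- **Goodness when `|A ∖ b| ≤ 1`** (rungs 0 and 1 of an induction on the number of relays; the
registered conclusion of `stub_goodStep` needs neither the low-neighbour hypothesis nor the
induction hypothesis here): if `b ∈ A` and `A.erase b` has at most one element then the quadruple
`(w, A, o, b)` is good in the skeleton's linear selection form.  Via `good_of_exchange` at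
`a₀` = the relay (or `b`) and `goodBridge_exchange_of_subset_pair`.
[Kozma–Nitzan arXiv:2401.12397 §3.2 p. 12] -/
theorem good_of_card_erase_le_one :
    ∀ (n : ℕ) (w : Sym2 (Fin n) → unitInterval) (A : Finset (Fin n)) (o b : Fin n),
      b ∈ A → (A.erase b).card ≤ 1 →
      ∀ (t : ℝ) (sel : Finset (Fin n) → Fin n), (∀ W, sel W ∈ A) →
        (∀ a ∈ A, 1 - t ≤ (prodBernoulli w).real (openConn a b)) →
        (prodBernoulli w).real ((⋃ a ∈ A, openConn o a) ∩ (openConn o b)ᶜ)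
          + ∑ W ∈ (Finset.univ : Finset (Finset (Fin n))).filter (fun W => o ∈ W ∧ Disjoint W A),
              (prodBernoulli w).real {ω : BondConfig (Fin n) | openCluster ω o = (W : Set (Fin n))}
                * (prodBernoulli w).real (openConnIn ((W : Set (Fin n))ᶜ) (sel W) b)ᶜ
          ≤ t := by
  intro n w A o b hbA hcard t sel hsel hlev
  -- a relay `a₀ ∈ A` with `A ⊆ {a₀, b}`
  obtain ⟨a₀, ha₀A, hA⟩ : ∃ a₀ ∈ A, A ⊆ {a₀, b} := by
    by_cases he : A.erase b = ∅
    · refine ⟨b, hbA, fun a haA => ?_⟩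
      rw [Finset.mem_insert, Finset.mem_singleton, or_self]
      by_contra hab
      have : a ∈ A.erase b := Finset.mem_erase.2 ⟨hab, haA⟩
      rw [he] at this
      exact absurd this (Finset.notMem_empty a)
    · obtain ⟨a₀, ha₀⟩ := Finset.nonempty_iff_ne_empty.2 he
      refine ⟨a₀, (Finset.mem_erase.1 ha₀).2, fun a haA => ?_⟩
      rw [Finset.mem_insert, Finset.mem_singleton]
      by_cases hab : a = b
      · exact Or.inr hab
      · exact Or.inl (Finset.card_le_one.1 hcard a (Finset.mem_erase.2 ⟨hab, haA⟩) a₀ ha₀)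
  exact good_of_exchange w A o b a₀ hbA ha₀A t sel (hlev a₀ ha₀A)
    (goodBridge_exchange_of_subset_pair w A o b a₀ hbA hA sel hsel)

end

end Summit.CriticalPhenomena.PercolationContinuityZ3.Theorems
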